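import Mathlib
import Literature.Computability.AlgebraicComplexity.Hyperdeterminant
import Literature.Computability.AlgebraicComplexity.Apolarity
import Literature.Computability.AlgebraicComplexity.BorderApolarityMembership
import Literature.Computability.AlgebraicComplexity.OrbitClosureProofs
import Summits.ValiantsHypothesis.ValiantsHypothesis.Theses.GCTMult
import Summits.ValiantsHypothesis.ValiantsHypothesis.Theorems.DetQPDetqpThesisStubSequentialApolarity
import Summits.ValiantsHypothesis.ValiantsHypothesis.Theorems.DetQPDetqpThesisStubDcPerPolyLeDcHyperdet

/-!
# Crux `DetQP.DetqpThesis` (stmt-ValiantsHypothesis-0315), line `four-dimensional-determinant` —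
# calibration of the bet `stub_noFixedWitnessQP` (C): witnesses versus membership; `GctThesis ⇒ C`

`pp := X₀₀^{m-n} · H_n(X_ι)` (padded four-dimensional determinant).  Contents:
* `hdc_mem_orbitClosure_of_witness` — a border-apolar witness over ANY nonzero form `Q` of degree
  `m` forces `Q ∈ Δ(det_m)` (general form of `BorderApolarity.mem_orbitClosure_of_witness`:
  perfect pairing in degree `m`, compactness of the unit sphere);
* `hdc_paddedHyperdet_isHomogeneous` / `_ne_zero` — `pp` is a nonzero form of degree `m`;
* `hdc_witness_iff_mem` — with stub B1 (landed, `stub_sequentialApolarity`): a plain witness for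
  `pp` exists iff `pp ∈ Δ(det_m)`; an `H(n,m,ι)`-stable witness a fortiori gives membership;
* `hdc_paddedPerPoly_mem_orbitClosure_paddedHyperdet` — `X₀₀^{m-n} per_n ∈ Δ(pp)` at the same
  `(n, m)` (Gurvits' identity `hyperdet_blockArr`, one row rescaled by `1/n!`, `End·f ⊆ Δ(f)`);
* `hdc_gctThesis_imp_noFixedWitnessQP` — **`GCTMult.GctThesis → C`** (crux stmt-0323 of route
  GCTMult implies the line's bet): C is sandwiched `GctThesis ⇒ C ⇒ X`, the line factors the known
  bridge through `H`, and its only added content is the `H`-stability normal form.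
Folklore (Buczyńska–Buczyński 2021 Thm 1; Gurvits 2004 Ex. 3.3; Mulmuley–Sohoni 2001 §4).
-/

open MvPolynomial Filter
open scoped BigOperators Topology Matrix

namespace Summit.ValiantsHypothesis.ValiantsHypothesis.Theorems.DetQPDetqpThesis.HdCalibration

set_option linter.dupNamespace false

open Literature.Computability.AlgebraicComplexity
open Literature.Computability.AlgebraicComplexity.BorderApolarity

/-- **A witness forces membership** (any nonzero form `Q` of degree `m`): `P_t ∈ GL·det_m`, all
subsequential limits of degree-`m` annihilators in `J m`, `J m ⌟ Q = 0` ⇒ `Q ∈ Δ(det_m)`.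
Adapted verbatim from `BorderApolarity.mem_orbitClosure_of_witness`. -/
theorem hdc_mem_orbitClosure_of_witness {m : ℕ} [NeZero m] (Q : MvPolynomial (Fin m × Fin m) ℂ)
    (hQhom : Q.IsHomogeneous m) (hQne : Q ≠ 0)
    (P : ℕ → MvPolynomial (Fin m × Fin m) ℂ) (J : ℕ → Set (MvPolynomial (Fin m × Fin m) ℂ))
    (hW1 : ∀ t, P t ∈ glOrbit (Fin m × Fin m) ℂ (detPoly (Fin m) ℂ))
    (hW3 : ∀ k ≤ m, ∀ (D : MvPolynomial (Fin m × Fin m) ℂ) (φ : ℕ → ℕ)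
      (Ds : ℕ → MvPolynomial (Fin m × Fin m) ℂ), StrictMono φ →
      (∀ t, (Ds t).IsHomogeneous k ∧ apolarAction (Ds t) (P (φ t)) = 0) →
      Tendsto (fun t => coeffVec (Ds t)) atTop (𝓝 (coeffVec D)) → D ∈ J k)
    (hW5 : ∀ k ≤ m, ∀ D ∈ J k, apolarAction D Q = 0) :
    Q ∈ orbitClosure (detPoly (Fin m) ℂ) := by
  have hPhom : ∀ t, (P t).IsHomogeneous m := fun t => by
    simpa [Fintype.card_fin] using isHomogeneous_of_mem_glOrbit_detPoly (hW1 t)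
  have hPne : ∀ t, P t ≠ 0 := fun t => ne_zero_of_mem_glOrbit_detPoly (hW1 t)
  -- weighted coefficient vectors `w t`, their norms, and the normalised vectors `v t`
  obtain ⟨w, hw⟩ : ∃ w : ℕ → (((Finset.univ : Finset (Fin m × Fin m)).finsuppAntidiag m) → ℂ),
      ∀ t, w t = fun d => coeff d.1 (P t) * ∏ i ∈ d.1.support, ((d.1 i).factorial : ℂ) :=
    ⟨_, fun t => rfl⟩
  have hwne : ∀ t, w t ≠ 0 := fun t => by
    rw [hw]; exact weightedCoeff_ne_zero (hPhom t) (hPne t)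
  have hnorm : ∀ t, ‖w t‖ ≠ 0 := fun t => norm_ne_zero_iff.2 (hwne t)
  have hnormC : ∀ t, ((‖w t‖ : ℝ) : ℂ) ≠ 0 := fun t => Complex.ofReal_ne_zero.2 (hnorm t)
  obtain ⟨v, hv⟩ : ∃ v : ℕ → (((Finset.univ : Finset (Fin m × Fin m)).finsuppAntidiag m) → ℂ),
      ∀ t, v t = ((‖w t‖ : ℝ) : ℂ)⁻¹ • w t := ⟨_, fun t => rfl⟩
  have hvs : ∀ t, v t ∈ Metric.sphere
      (0 : ((Finset.univ : Finset (Fin m × Fin m)).finsuppAntidiag m) → ℂ) 1 := by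
    intro t
    rw [mem_sphere_zero_iff_norm, hv, norm_smul, norm_inv, Complex.norm_real, norm_norm,
      inv_mul_cancel₀ (hnorm t)]
  obtain ⟨u, hu, φ, hφ, hlim⟩ := (isCompact_sphere _ _).tendsto_subseq hvs
  have hlim1 : Tendsto (fun t => v (φ t)) atTop (𝓝 u) := hlim
  have hune : u ≠ 0 := by
    intro h
    rw [h, mem_sphere_zero_iff_norm, norm_zero] at hu
    exact zero_ne_one hu
  have hwv : ∀ t, (fun d : ((Finset.univ : Finset (Fin m × Fin m)).finsuppAntidiag m) =>
      coeff d.1 (P t) * ∏ i ∈ d.1.support, ((d.1 i).factorial : ℂ)) = ((‖w t‖ : ℝ) : ℂ) • v t := by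
    intro t
    rw [← hw, hv, smul_smul, mul_inv_cancel₀ (hnormC t), one_smul]
  -- Step 1: forms in the hyperplane `Σ D_d u_d = 0` lie in `J m`
  have key : ∀ D : MvPolynomial (Fin m × Fin m) ℂ, D.IsHomogeneous m →
      (∑ d : ((Finset.univ : Finset (Fin m × Fin m)).finsuppAntidiag m), coeff d.1 D * u d) = 0 →
      D ∈ J m :=
    fun D hD hLD => mem_of_sum_eq_zero hPhom (hW3 m le_rfl) v _ hwv hune hφ hlim1 hD hLD
  -- Step 2: the weighted vector of `Q` is proportional to `u`
  have himp : ∀ c : ((Finset.univ : Finset (Fin m × Fin m)).finsuppAntidiag m) → ℂ,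
      (∑ d, c d * u d) = 0 →
      (∑ d, c d * (coeff d.1 Q * ∏ i ∈ d.1.support, ((d.1 i).factorial : ℂ))) = 0 := by
    intro c hc
    have hhom := isHomogeneous_sum_monomial (σ := Fin m × Fin m) (j := m) c
    have hD := key _ hhom (by
      simp only [coeff_sum_monomial]
      exact hc)
    have h5 := hW5 m le_rfl _ hD
    rw [apolarAction_eq_zero_iff_sum hhom hQhom] at h5
    simp only [coeff_sum_monomial] at h5
    exact h5
  obtain ⟨μ, hμ⟩ := exists_smul_of_sum_eq_zero_imp u _ hune himp
  have hμne : μ ≠ 0 := by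
    rintro rfl
    rw [zero_smul] at hμ
    exact weightedCoeff_ne_zero hQhom hQne hμ
  -- Step 3: the rescaled orbit sequence converges to `Q` coefficientwise
  obtain ⟨c, hc⟩ : ∃ c : ℕ → ℂ, ∀ t, c t = μ * ((‖w (φ t)‖ : ℝ) : ℂ)⁻¹ := ⟨_, fun t => rfl⟩
  have hcne : ∀ t, c t ≠ 0 := fun t => by
    rw [hc]; exact mul_ne_zero hμne (inv_ne_zero (hnormC (φ t)))
  have hlim2 : Tendsto (fun t => coeffVec (c t • P (φ t))) atTop (𝓝 (coeffVec Q)) := by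
    rw [tendsto_pi_nhds]
    intro d
    by_cases hd : d.degree = m
    · have hdmem : d ∈ (Finset.univ : Finset (Fin m × Fin m)).finsuppAntidiag m :=
        mem_finsuppAntidiag_univ_iff.2 hd
      have hvd : Tendsto (fun t => v (φ t) ⟨d, hdmem⟩) atTop (𝓝 (u ⟨d, hdmem⟩)) :=
        ((continuous_apply _).tendsto u).comp hlim1
      have hfact : (∏ i ∈ d.support, ((d i).factorial : ℂ)) ≠ 0 := prod_factorial_ne_zero d
      have hwd : ∀ t, w t ⟨d, hdmem⟩ = coeff d (P t) * ∏ i ∈ d.support, ((d i).factorial : ℂ) :=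
        fun t => by rw [hw]
      have h1 : (fun t => coeffVec (c t • P (φ t)) d) =
          fun t => (μ * (∏ i ∈ d.support, ((d i).factorial : ℂ))⁻¹) * v (φ t) ⟨d, hdmem⟩ := by
        funext t
        rw [coeffVec_apply, coeff_smul, smul_eq_mul, hc, hv]
        simp only [Pi.smul_apply, smul_eq_mul, hwd]
        field_simp
      have h2 : coeffVec Q d =
          (μ * (∏ i ∈ d.support, ((d i).factorial : ℂ))⁻¹) * u ⟨d, hdmem⟩ := by
        have := congrFun hμ ⟨d, hdmem⟩
        simp only [Pi.smul_apply, smul_eq_mul] at this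
        rw [coeffVec_apply]
        field_simp
        linear_combination this
      rw [h1, h2]
      exact hvd.const_mul _
    · have h1 : (fun t => coeffVec (c t • P (φ t)) d) = fun _ => 0 := by
        funext t
        rw [coeffVec_apply, coeff_smul, (hPhom (φ t)).coeff_eq_zero hd, smul_zero]
      have h2 : coeffVec Q d = 0 := hQhom.coeff_eq_zero hd
      rw [h1, h2]
      exact tendsto_const_nhds
  -- Step 4: the rescaled sequence stays in the orbit (cone), so `Q` is in the closure
  exact mem_orbitClosure_of_tendsto (φ := id) (fun t => c t • P (φ t))
    (fun t => smul_mem_glOrbit_detPoly (hW1 _) (hcne t)) hlim2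

/-! ## The padded four-dimensional determinant is a nonzero form of degree `m` -/

/-- `H_n` is a form of degree `n`. -/
theorem hdc_hyperdet_X_isHomogeneous (n : ℕ) :
    (hyperdet fun I : Fin 4 → Fin n => (X I : MvPolynomial (Fin 4 → Fin n) ℂ)).IsHomogeneous n := by
  unfold hyperdet
  apply IsHomogeneous.sum
  intro σ _
  have hsign : (∏ j, ((Equiv.Perm.sign (σ j) : ℤ) : MvPolynomial (Fin 4 → Fin n) ℂ)).IsHomogeneous 0 := by
    rw [← Int.cast_prod, ← map_intCast (C : ℂ →+* MvPolynomial (Fin 4 → Fin n) ℂ)]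
    exact isHomogeneous_C _ _
  have hprod : (∏ i : Fin n, (X (fun j => σ j i) : MvPolynomial (Fin 4 → Fin n) ℂ)).IsHomogeneous n := by
    have := IsHomogeneous.prod (Finset.univ : Finset (Fin n))
      (fun i => (X (fun j => σ j i) : MvPolynomial (Fin 4 → Fin n) ℂ)) (fun _ => 1)
      (fun i _ => isHomogeneous_X ℂ _)
    simpa using this
  simpa using hsign.mul hprod

/-- The padded `X₀₀^{m-n} H_n(X_ι)` is a form of degree `m` (`n ≤ m`). -/
theorem hdc_paddedHyperdet_isHomogeneous {n m : ℕ} [NeZero m] (hnm : n ≤ m)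
    (ι : (Fin 4 → Fin n) → Fin m × Fin m) :
    (X ((0 : Fin m), (0 : Fin m)) ^ (m - n) *
      rename ι (hyperdet fun I : Fin 4 → Fin n => (X I : MvPolynomial (Fin 4 → Fin n) ℂ))).IsHomogeneous m := by
  have h1 : ((X ((0 : Fin m), (0 : Fin m)) : MvPolynomial (Fin m × Fin m) ℂ) ^ (m - n)).IsHomogeneous
      (m - n) := by
    simpa using (isHomogeneous_X ℂ ((0 : Fin m), (0 : Fin m))).pow (m - n)
  have h2 : (rename ι (hyperdet fun I : Fin 4 → Fin n =>
      (X I : MvPolynomial (Fin 4 → Fin n) ℂ))).IsHomogeneous n :=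
    (hdc_hyperdet_X_isHomogeneous n).rename_isHomogeneous
  have h := h1.mul h2
  rwa [Nat.sub_add_cancel hnm] at h

/-- `H_n ≠ 0`: its value at the diagonal array `𝟙[I constant]` is `n!` (`hyperdet_diagArr`). -/
theorem hdc_hyperdet_X_ne_zero (n : ℕ) :
    (hyperdet fun I : Fin 4 → Fin n => (X I : MvPolynomial (Fin 4 → Fin n) ℂ)) ≠ 0 := by
  intro h
  have h1 := congrArg (MvPolynomial.eval (diagArr (ℓ := 4) fun _ : Fin n => (1 : ℂ))) h
  rw [map_zero, map_hyperdet] at h1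
  simp only [eval_X] at h1
  have h2 : hyperdet (diagArr (ℓ := 4) fun _ : Fin n => (1 : ℂ)) = 0 := h1
  rw [hyperdet_diagArr (by norm_num) (by decide)] at h2
  simp only [Finset.prod_const_one, mul_one, Nat.cast_eq_zero] at h2
  exact Nat.factorial_ne_zero n h2

/-- The padded `X₀₀^{m-n} H_n(X_ι)` is nonzero for an injective placement `ι`. -/
theorem hdc_paddedHyperdet_ne_zero {n m : ℕ} [NeZero m]
    (ι : (Fin 4 → Fin n) → Fin m × Fin m) (hι : Function.Injective ι) :
    X ((0 : Fin m), (0 : Fin m)) ^ (m - n) *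
      rename ι (hyperdet fun I : Fin 4 → Fin n => (X I : MvPolynomial (Fin 4 → Fin n) ℂ)) ≠ 0 := by
  refine mul_ne_zero (pow_ne_zero _ (X_ne_zero _)) fun h => ?_
  exact hdc_hyperdet_X_ne_zero n (rename_injective _ hι (by rw [h, map_zero]))

/-! ## Witnesses versus membership for the padded four-dimensional determinant -/

/-- **Plain witnesses ⇔ membership.**  For `n ≤ m` and an injective placement, a border-apolar
witness `(P, J)` inside `Ann(X₀₀^{m-n} H_n(X_ι))` exists iff `X₀₀^{m-n} H_n(X_ι) ∈ Δ(det_m)`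
(`→`: `hdc_mem_orbitClosure_of_witness`; `←`: stub B1, `stub_sequentialApolarity`). -/
theorem hdc_witness_iff_mem {n m : ℕ} [NeZero m] (hnm : n ≤ m)
    (ι : (Fin 4 → Fin n) → Fin m × Fin m) (hι : Function.Injective ι) :
    (∃ (P : ℕ → MvPolynomial (Fin m × Fin m) ℂ) (J : ℕ → Set (MvPolynomial (Fin m × Fin m) ℂ)),
      (∀ t : ℕ, P t ∈ glOrbit (Fin m × Fin m) ℂ (detPoly (Fin m) ℂ)) ∧
      IsBorderApolarLimit m P J ∧
      (∀ k ≤ m, ∀ D ∈ J k, apolarAction D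
        (X ((0 : Fin m), (0 : Fin m)) ^ (m - n) *
          rename ι (hyperdet fun I : Fin 4 → Fin n => (X I : MvPolynomial (Fin 4 → Fin n) ℂ))) = 0)) ↔
    X ((0 : Fin m), (0 : Fin m)) ^ (m - n) *
        rename ι (hyperdet fun I : Fin 4 → Fin n => (X I : MvPolynomial (Fin 4 → Fin n) ℂ)) ∈
      orbitClosure (detPoly (Fin m) ℂ) := by
  refine ⟨?_, fun hmem => Summit.ValiantsHypothesis.ValiantsHypothesis.Theorems.DetQPDetqpThesis.stub_sequentialApolarity _ hmem⟩
  rintro ⟨P, J, hW1, hJ, hW5⟩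
  exact hdc_mem_orbitClosure_of_witness _ (hdc_paddedHyperdet_isHomogeneous hnm ι)
    (hdc_paddedHyperdet_ne_zero ι hι) P J hW1 hJ.2 hW5

/-- **An `H(n,m,ι)`-stable witness gives membership** (drop the stability clause). -/
theorem hdc_mem_of_fixedWitness {n m : ℕ} [NeZero m] (hnm : n ≤ m)
    (ι : (Fin 4 → Fin n) → Fin m × Fin m) (hι : Function.Injective ι)
    (h : ∃ (P : ℕ → MvPolynomial (Fin m × Fin m) ℂ) (J : ℕ → Set (MvPolynomial (Fin m × Fin m) ℂ)),
      (∀ t : ℕ, P t ∈ glOrbit (Fin m × Fin m) ℂ (detPoly (Fin m) ℂ)) ∧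
      IsBorderApolarLimit m P J ∧
      (∀ A : Matrix.GeneralLinearGroup (Fin m × Fin m) ℂ,
        let M : Matrix (Fin m × Fin m) (Fin m × Fin m) ℂ := A;
        (∃ a : Fin 4 → Matrix (Fin n) (Fin n) ℂ,
            (∀ (r : Fin 4) (i j : Fin n), j < i → a r i j = 0) ∧
            (∀ I I' : Fin 4 → Fin n, M (ι I') (ι I) = ∏ r, a r (I' r) (I r)) ∧
            M (0, 0) (0, 0) ^ (m - n) * ∏ r, ∏ i, a r i i = 1) →
        (∀ (I : Fin 4 → Fin n) (p : Fin m × Fin m), p ∉ Set.range ι → M p (ι I) = 0) →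
        (∀ p : Fin m × Fin m, p ≠ (0, 0) → M p (0, 0) = 0) →
        (∀ p q : Fin m × Fin m, p ∉ Set.range ι → p ≠ (0, 0) → q ∉ Set.range ι → q ≠ (0, 0) →
            (p.1 : ℕ) * m + (p.2 : ℕ) < (q.1 : ℕ) * m + (q.2 : ℕ) → M q p = 0) →
        ∀ k ≤ m, ∀ D ∈ J k, linSubst (Fin m × Fin m) ℂ Mᵀ D ∈ J k) ∧
      (∀ k ≤ m, ∀ D ∈ J k, apolarAction D
        (X ((0 : Fin m), (0 : Fin m)) ^ (m - n) *
          rename ι (hyperdet fun I : Fin 4 → Fin n => (X I : MvPolynomial (Fin 4 → Fin n) ℂ))) = 0)) :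
    X ((0 : Fin m), (0 : Fin m)) ^ (m - n) *
        rename ι (hyperdet fun I : Fin 4 → Fin n => (X I : MvPolynomial (Fin 4 → Fin n) ℂ)) ∈
      orbitClosure (detPoly (Fin m) ℂ) := by
  obtain ⟨P, J, hW1, hJ, -, hW5⟩ := h
  exact (hdc_witness_iff_mem hnm ι hι).1 ⟨P, J, hW1, hJ, hW5⟩

/-! ## The padded permanent is a degeneration of the padded four-dimensional determinant -/

/-- **`X₀₀^{m-n} per_n ∈ Δ(X₀₀^{m-n} H_n(X_ι))`** (`1 ≤ n ≤ m`, `ι` injective missing `(0,0)`):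
the substitution `X₀₀ ↦ X₀₀`, `X_{ι(i,j,k,l)} ↦ [k = i][l = j] · c_i · X_{(e i, e j)}` (`e` the
bottom-right block embedding, `c_{0} = 1/n!`, `c_i = 1` otherwise), all other variables `↦ 0`,
maps the padded hyperdeterminant to the padded permanent (Gurvits' identity, `hyperdet_blockArr`,
and `per(diag(c)·Y) = (∏ c_i)·per(Y)`), and `End · f ⊆ Δ(f)` (`endOrbit_subset_orbitClosure_holds`). -/
theorem hdc_paddedPerPoly_mem_orbitClosure_paddedHyperdet {n m : ℕ} [NeZero m] (hn : 1 ≤ n)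
    (hnm : n ≤ m) (ι : (Fin 4 → Fin n) → Fin m × Fin m) (hι : Function.Injective ι)
    (hℓ : ((0 : Fin m), (0 : Fin m)) ∉ Set.range ι) :
    paddedPerPoly ℂ n m ∈ orbitClosure (X ((0 : Fin m), (0 : Fin m)) ^ (m - n) *
      rename ι (hyperdet fun I : Fin 4 → Fin n => (X I : MvPolynomial (Fin 4 → Fin n) ℂ))) := by
  classical
  -- the block embedding and the row weights
  set ε : BlockIdx n m ≃ Fin n := Fintype.equivFinOfCardEq (card_blockIdx hnm) with hε
  set e : Fin n → Fin m := fun i => ((ε.symm i : BlockIdx n m) : Fin m) with he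
  set i₀ : Fin n := ⟨0, hn⟩ with hi₀
  set c : Fin n → ℂ := fun i => if i = i₀ then ((n.factorial : ℂ))⁻¹ else 1 with hc
  have hfact : (n.factorial : ℂ) ≠ 0 := by exact_mod_cast Nat.factorial_ne_zero n
  -- the substitution matrix (columns = images of the variables)
  set B : Matrix (Fin m × Fin m) (Fin m × Fin m) ℂ := fun j v =>
    if v = (0, 0) then (if j = (0, 0) then 1 else 0)
    else if h : ∃ I, ι I = v then
      (if h.choose 2 = h.choose 0 ∧ h.choose 3 = h.choose 1 then
        (if j = (e (h.choose 0), e (h.choose 1)) then c (h.choose 0) else 0) else 0)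
    else 0 with hB
  -- images of the variables
  have hB0 : linSubst (Fin m × Fin m) ℂ B (X (0, 0)) = X (0, 0) := by
    rw [linSubst_X]
    rw [Finset.sum_eq_single ((0 : Fin m), (0 : Fin m))]
    · simp [hB]
    · intro j _ hj
      simp [hB, hj]
    · intro h; exact absurd (Finset.mem_univ _) h
  have hchoose : ∀ I : Fin 4 → Fin n, ∀ h : ∃ I', ι I' = ι I, h.choose = I :=
    fun I h => hι h.choose_spec
  have hBI : ∀ I : Fin 4 → Fin n, linSubst (Fin m × Fin m) ℂ B (X (ι I)) =
      if I 2 = I 0 ∧ I 3 = I 1 then C (c (I 0)) * X (e (I 0), e (I 1)) else 0 := by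
    intro I
    have hI0 : ι I ≠ (0, 0) := fun h0 => hℓ ⟨I, h0⟩
    have hex : ∃ I', ι I' = ι I := ⟨I, rfl⟩
    rw [linSubst_X]
    have hcol : ∀ j, B j (ι I) = if I 2 = I 0 ∧ I 3 = I 1 then
        (if j = (e (I 0), e (I 1)) then c (I 0) else 0) else 0 := by
      intro j
      simp only [hB, if_neg hI0, dif_pos hex, hchoose I hex]
    by_cases hcond : I 2 = I 0 ∧ I 3 = I 1
    · rw [if_pos hcond, Finset.sum_eq_single (e (I 0), e (I 1))]
      · rw [hcol, if_pos hcond, if_pos rfl, smul_eq_C_mul]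
      · intro j _ hj
        rw [hcol, if_pos hcond, if_neg hj, zero_smul]
      · intro h; exact absurd (Finset.mem_univ _) h
    · rw [if_neg hcond]
      exact Finset.sum_eq_zero fun j _ => by rw [hcol, if_neg hcond, zero_smul]
  -- the substituted padded hyperdeterminant
  set M₁ : Matrix (Fin n) (Fin n) (MvPolynomial (Fin m × Fin m) ℂ) := Matrix.of fun i j => X (e i, e j)
    with hM₁
  have hsub : linSubst (Fin m × Fin m) ℂ B (X ((0 : Fin m), (0 : Fin m)) ^ (m - n) *
      rename ι (hyperdet fun I : Fin 4 → Fin n => (X I : MvPolynomial (Fin 4 → Fin n) ℂ))) =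
      X ((0 : Fin m), (0 : Fin m)) ^ (m - n) * M₁.permanent := by
    rw [map_mul, map_pow, hB0]
    congr 1
    -- push `rename ι` and `linSubst B` through the hyperdeterminant
    have h1 : rename ι (hyperdet fun I : Fin 4 → Fin n => (X I : MvPolynomial (Fin 4 → Fin n) ℂ)) =
        hyperdet fun I : Fin 4 → Fin n => (X (ι I) : MvPolynomial (Fin m × Fin m) ℂ) := by
      rw [show (rename ι : MvPolynomial (Fin 4 → Fin n) ℂ →ₐ[ℂ] MvPolynomial (Fin m × Fin m) ℂ)
          (hyperdet fun I : Fin 4 → Fin n => (X I : MvPolynomial (Fin 4 → Fin n) ℂ)) =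
          (rename ι : MvPolynomial (Fin 4 → Fin n) ℂ →ₐ[ℂ] MvPolynomial (Fin m × Fin m) ℂ).toRingHom
            (hyperdet fun I : Fin 4 → Fin n => (X I : MvPolynomial (Fin 4 → Fin n) ℂ)) from rfl,
        map_hyperdet]
      simp
    have h2 : linSubst (Fin m × Fin m) ℂ B
        (hyperdet fun I : Fin 4 → Fin n => (X (ι I) : MvPolynomial (Fin m × Fin m) ℂ)) =
        hyperdet fun I : Fin 4 → Fin n => linSubst (Fin m × Fin m) ℂ B (X (ι I)) := by
      rw [show linSubst (Fin m × Fin m) ℂ B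
          (hyperdet fun I : Fin 4 → Fin n => (X (ι I) : MvPolynomial (Fin m × Fin m) ℂ)) =
          (linSubst (Fin m × Fin m) ℂ B).toRingHom
            (hyperdet fun I : Fin 4 → Fin n => (X (ι I) : MvPolynomial (Fin m × Fin m) ℂ)) from rfl,
        map_hyperdet]
      rfl
    rw [h1, h2]
    simp only [hBI]
    have h3 := hyperdet_blockArr (R := MvPolynomial (Fin m × Fin m) ℂ)
      (Matrix.of fun i j : Fin n => C (c i) * X (e i, e j))
    simp only [Matrix.of_apply] at h3
    rw [h3]
    -- `per(diag(c) · M₁) = (1/n!) · per(M₁)`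
    have h4 : (Matrix.of fun i j : Fin n => C (c i) * (X (e i, e j) : MvPolynomial (Fin m × Fin m) ℂ)) =
        M₁.updateRow i₀ ((C ((n.factorial : ℂ))⁻¹ : MvPolynomial (Fin m × Fin m) ℂ) • M₁ i₀) := by
      ext i j
      simp only [Matrix.of_apply, Matrix.updateRow_apply, hM₁, Pi.smul_apply, smul_eq_mul]
      by_cases hi : i = i₀
      · subst hi
        simp [hc]
      · simp [hc, hi]
    rw [h4, Matrix.permanent_updateRow_smul, Matrix.updateRow_eq_self, ← mul_assoc,
      show ((n.factorial : MvPolynomial (Fin m × Fin m) ℂ)) * C ((n.factorial : ℂ))⁻¹ = 1 by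
        rw [← map_natCast (C : ℂ →+* MvPolynomial (Fin m × Fin m) ℂ), ← map_mul,
          mul_inv_cancel₀ hfact, map_one], one_mul]
  -- the permanent of the block is the renamed generic permanent of the block index type
  have hper : M₁.permanent =
      rename (fun ij : BlockIdx n m × BlockIdx n m => ((ij.1 : Fin m), (ij.2 : Fin m)))
        (perPoly (BlockIdx n m) ℂ) := by
    rw [← rename_perPoly_equiv (k := ℂ) ε.symm, rename_rename]
    simp only [perPoly, Matrix.permanent, map_sum, map_prod, Matrix.mvPolynomialX_apply, rename_X,
      Function.comp_apply, Prod.map_apply, hM₁, Matrix.of_apply]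
    rfl
  have hpp : linSubst (Fin m × Fin m) ℂ B (X ((0 : Fin m), (0 : Fin m)) ^ (m - n) *
      rename ι (hyperdet fun I : Fin 4 → Fin n => (X I : MvPolynomial (Fin 4 → Fin n) ℂ))) =
      paddedPerPoly ℂ n m := by
    rw [hsub, hper]
    rfl
  rw [← hpp]
  exact endOrbit_subset_orbitClosure_holds _ ⟨B, rfl⟩

/-! ## `GCTMult.GctThesis ⇒ C` -/

/-- **`GCTMult.GctThesis` (crux stmt-ValiantsHypothesis-0323) implies the line's bet C**: a
witness in the window would put the padded hyperdeterminant (`hdc_mem_of_fixedWitness`), hence the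
padded permanent (`hdc_paddedPerPoly_mem_orbitClosure_paddedHyperdet`,
`orbitClosure_subset_of_mem_holds`), into `Δ(det_m)`. -/
theorem hdc_gctThesis_imp_noFixedWitnessQP
    (hG : Summit.ValiantsHypothesis.ValiantsHypothesis.Theses.GCTMult.GctThesis) :
    ∀ c : ℕ, ∃ n₀ : ℕ, ∀ n ≥ n₀, ∀ (m : ℕ) [NeZero m], n ^ 2 + 1 ≤ m →
      m ≤ 2 ^ ((Nat.log 2 n + c) ^ c) →
      ∀ ι : (Fin 4 → Fin n) → Fin m × Fin m, Function.Injective ι →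
        ((0 : Fin m), (0 : Fin m)) ∉ Set.range ι →
        ¬ ∃ (P : ℕ → MvPolynomial (Fin m × Fin m) ℂ) (J : ℕ → Set (MvPolynomial (Fin m × Fin m) ℂ)),
          (∀ t : ℕ, P t ∈ glOrbit (Fin m × Fin m) ℂ (detPoly (Fin m) ℂ)) ∧
          IsBorderApolarLimit m P J ∧
          (∀ A : Matrix.GeneralLinearGroup (Fin m × Fin m) ℂ,
            let M : Matrix (Fin m × Fin m) (Fin m × Fin m) ℂ := A;
            (∃ a : Fin 4 → Matrix (Fin n) (Fin n) ℂ,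
                (∀ (r : Fin 4) (i j : Fin n), j < i → a r i j = 0) ∧
                (∀ I I' : Fin 4 → Fin n, M (ι I') (ι I) = ∏ r, a r (I' r) (I r)) ∧
                M (0, 0) (0, 0) ^ (m - n) * ∏ r, ∏ i, a r i i = 1) →
            (∀ (I : Fin 4 → Fin n) (p : Fin m × Fin m), p ∉ Set.range ι → M p (ι I) = 0) →
            (∀ p : Fin m × Fin m, p ≠ (0, 0) → M p (0, 0) = 0) →
            (∀ p q : Fin m × Fin m, p ∉ Set.range ι → p ≠ (0, 0) → q ∉ Set.range ι → q ≠ (0, 0) →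
                (p.1 : ℕ) * m + (p.2 : ℕ) < (q.1 : ℕ) * m + (q.2 : ℕ) → M q p = 0) →
            ∀ k ≤ m, ∀ D ∈ J k, linSubst (Fin m × Fin m) ℂ Mᵀ D ∈ J k) ∧
          (∀ k ≤ m, ∀ D ∈ J k, apolarAction D
            (X ((0 : Fin m), (0 : Fin m)) ^ (m - n) *
              rename ι (hyperdet fun I : Fin 4 → Fin n => (X I : MvPolynomial (Fin 4 → Fin n) ℂ))) = 0) := by
  intro c
  obtain ⟨n₀, hn₀⟩ := hG c
  refine ⟨max n₀ 1, fun n hn m _ hm hmc ι hι hℓ hwit => ?_⟩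
  have hn1 : 1 ≤ n := le_of_max_le_right hn
  have hnn₀ : n₀ ≤ n := le_of_max_le_left hn
  have hnm : n ≤ m := by nlinarith
  have hmem := hdc_mem_of_fixedWitness hnm ι hι hwit
  have hper : paddedPerPoly ℂ n m ∈ orbitClosure (detPoly (Fin m) ℂ) :=
    orbitClosure_subset_of_mem_holds hmem
      (hdc_paddedPerPoly_mem_orbitClosure_paddedHyperdet hn1 hnm ι hι hℓ)
  exact hn₀ n hnn₀ m hnm hmc hper

end Summit.ValiantsHypothesis.ValiantsHypothesis.Theorems.DetQPDetqpThesis.HdCalibration
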